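import Literature.Computability.FineGrained.MinPlusProductToAPSPProgram
import Literature.Computability.FineGrained.NegativeTriangleToAPSP
import Literature.Computability.Cryptography.ProductLayeredGraph
import HarnessLib

/-!
# Distance product `≤₃` APSP (VW–W 2018, proof of Thm. 5.1): the verified reduction

This file discharges the named fact `minPlusProduct_fgReducible_APSP` of
`Literature.Computability.FineGrained.SubcubicEquivalencesAPSP` — one of the four printed steps of
the subcubic equivalence of APSP and Negative Triangle (Vassilevska Williams–Williams, J. ACM 65
(2018), Thm. 1.1; the step is the gadget in the proof of Thm. 5.1, p. 27:22: "the shortest path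
between `i` and `k` using exactly two edges, thus computing the `(min,+)` product of `A` and `B`") —
by assembling

* the structured word-RAM oracle program `MinPlusToAPSP.prog` and the semantics of its phases
  (`Literature.Computability.FineGrained.MinPlusProductToAPSPProgram`),
* the product layered graph and its distance formula `shortestDist_productLayeredGraph`
  (`Literature.Computability.Cryptography.ProductLayeredGraph`), and
* the output phases of the square-and-multiply driver
  (`Literature.Computability.FineGrained.APSPPowerDriver`) and the encoding estimates of
  `SubcubicEquivalencesAPSP`,

into `minPlusProduct_fgReducible_APSP_same c : FGReducible (MinPlusProduct c) (n ↦ n³) (APSP c)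
(n ↦ n³)` (same weight exponent on both sides) and
**`minPlusProduct_fgReducible_APSP_holds : minPlusProduct_fgReducible_APSP`**.

## The steps

1. `query_cells`, `readSeg_query`: after the two row loops the query block holds `qseg A B` — the
   header `3 n` and, at offset `m = u N + v` (`N = 3 n`), the code of `A` at the arcs `i₀ → j₁`
   (`u = i < n`, `v = n + j`), the code of `B` at the arcs `j₁ → k₂` (`u = n + j`, `v = 2 n + k`), and
   `0 = ⌜⊤⌝` elsewhere (`qcell`; the row windows are decoded by `mem_window_iff`);
2. `prog_spec`: the whole run — relocation, setup, the two row loops, the query, the answer rows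
   copied over the block of `A`, re-layout, staging and the final copy — ends within
   `49 n² + 27 n + 75` steps with `mem 0 = n² + 1`, `mem 1 = n`, `mem (2 + t) =` the answer word of
   the distance `(t / n)₀ ↝ (t mod n)₂`, and query log `[qseg A B]`, for any oracle whose answer to
   `qseg A B` has the length of an encoded `3 n × 3 n` matrix and small words;
3. `qseg_eq`: `qseg A B = encodeMatrixWithTop (productLayeredGraph A B)`, an `APSP c` instance of
   size `3 n` (`productLayeredGraph_mem_APSP`), so an oracle answering `APSP c` returns
   `⌜shortestDist (productLayeredGraph A B)⌝`, whose `(i₀, k₂)` entries are the codes of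
   `minPlusProduct A B i k` (`shortestDist_productLayeredGraph`): the output is
   `⌜minPlusProduct A B⌝` (`readOut_eq`);
4. budgets (`minPlusProduct_fgReducible_APSP_same`): word size `(c + 8) · width` (`pTop_lt_capacity`,
   `answer_lt_capacity`); for `ε > 0` take `δ = min ε (1/3)` and `C = 80`: time
   `49 n² + 27 n + 76 ≤ 76 (n³)^{1-δ} + 76` (`sq_le_budget`), the ledger of the single query
   `((3n)³)^{1-ε} ≤ 27 (n³)^{1-δ} + 1` (`ledger_le_three`) and its length `9 n² + 1`.

Everything here is proved; the reduction is deterministic, as in print.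

## References

* V. Vassilevska Williams, R. R. Williams, *Subcubic equivalences between path, matrix, and triangle
  problems*, J. ACM 65 (2018), Art. 27: Thm. 1.1 (p. 27:3), Def. 3.1 (p. 27:10), proof of Thm. 5.1
  (p. 27:22). doi:10.1145/3186893
* V. Vassilevska Williams, *On some fine-grained questions in algorithms and complexity*, Proc. ICM
  2018, §2, Def. 2.1 (fine-grained reductions on the word RAM).
-/

namespace Literature.Computability.FineGrained.MinPlusToAPSP

open Cryptography Cryptography.WordRAM Cryptography.WordRAM.SProg Matrix

/-! ### Layout cross-references to the driver -/

/-- `pB n` is the driver's power block base `APSPPower.dQP n` (so the relocated `MinPlusProduct`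
input is literally the operand layout of `APSPPower.ProdSpec`). [folklore] -/
theorem pB_eq_dQP (n : ℕ) : pB n = APSPPower.dQP n := by
  rw [APSPPower.dQP_eq]; rfl

/-- `pQ n` is the driver's block base `APSPPower.dQP2 n`. [folklore] -/
theorem pQ_eq_dQP2 (n : ℕ) : pQ n = APSPPower.dQP2 n := by
  rw [APSPPower.dQP2_eq]; rfl

/-! ### Row-major windows -/

/-- **Decoding a row window**: `m` lies in the window `[i N + lo, i N + hi)` of row `i` (`hi ≤ N`)
iff `m / N = i` and `lo ≤ m mod N < hi`. [folklore] -/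
theorem mem_window_iff {N i lo hi m : ℕ} (hhi : hi ≤ N) :
    (i * N + lo ≤ m ∧ m < i * N + hi) ↔ (m / N = i ∧ lo ≤ m % N ∧ m % N < hi) := by
  rcases Nat.eq_zero_or_pos N with rfl | hN
  · constructor
    · rintro ⟨-, h⟩; omega
    · rintro ⟨-, -, h⟩; omega
  · have hdm : m / N * N + m % N = m := Nat.div_add_mod' m N
    have hmod : m % N < N := Nat.mod_lt m hN
    constructor
    · rintro ⟨h1, h2⟩
      have hdiv : m / N = i := by
        refine Nat.div_eq_of_lt_le (by omega) ?_
        rw [Nat.succ_mul]; omega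
      rw [hdiv] at hdm
      exact ⟨hdiv, by omega, by omega⟩
    · rintro ⟨hdiv, h1, h2⟩
      rw [hdiv] at hdm
      omega

section semantics

variable {n w : ℕ} {O : List ℕ → List ℕ} (A B : Matrix (Fin n) (Fin n) (WithTop ℤ))

/-! ### The query block -/

/-- The intended content of cell `m = u N + v` (`N = 3 n`) of the query matrix: the code of `A i j`
on the arc `i₀ → j₁` (`u = i`, `v = n + j`), the code of `B j k` on the arc `j₁ → k₂` (`u = n + j`,
`v = 2 n + k`), and `0 = ⌜⊤⌝` (no arc) elsewhere. [folklore] -/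
def qcell (m : ℕ) : ℕ :=
  if m / (3 * n) < n ∧ n ≤ m % (3 * n) ∧ m % (3 * n) < 2 * n then
    codeA A (m / (3 * n) * n + (m % (3 * n) - n))
  else if n ≤ m / (3 * n) ∧ m / (3 * n) < 2 * n ∧ 2 * n ≤ m % (3 * n) then
    codeB B ((m / (3 * n) - n) * n + (m % (3 * n) - 2 * n))
  else 0

/-- The query segment: the header `3 n` and the `(3 n)²` cells. [folklore] -/
def qseg : List ℕ := (3 * n) :: List.ofFn fun m : Fin (3 * n * (3 * n)) => qcell A B m

/-- The query segment has the length of an encoded `3 n × 3 n` matrix. [folklore] -/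
theorem qseg_length : (qseg A B).length = 9 * (n * n) + 1 := by
  simp [qseg]; ring

/-- **The cells of the query block after the two row loops.** From the data `H₁` after the setup
(codes of `A` and `B` in place, zero above `pQ n`), the row loop of `A` (rows `i < n` of `n` words to
`pQ n + 1 + n + i N`) giving `H₂`, and the row loop of `B` (rows `j < n` to
`pQ n + 1 + n N + 2 n + j N`) giving `H₄`, cell `m` of the query matrix holds `qcell A B m`. [folklore] -/
theorem query_cells {H₁ H₂ H₄ : ℕ → ℕ}
    (hH₁A : ∀ t, t < n * n → H₁ (pA n + 1 + t) = codeA A t)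
    (hH₁B : ∀ t, t < n * n → H₁ (pB n + 1 + t) = codeB B t)
    (hH₁hi : ∀ a, pQ n + 1 ≤ a → H₁ a = 0)
    (hrowsA : ∀ i, i < n → ∀ j, j < n →
      H₂ (pQ n + 1 + n + i * (3 * n) + j) = H₁ (pA n + 1 + i * n + j))
    (hothA : ∀ a, (∀ i, i < n →
      ¬ (pQ n + 1 + n + i * (3 * n) ≤ a ∧ a < pQ n + 1 + n + i * (3 * n) + n)) → H₂ a = H₁ a)
    (hrowsB : ∀ j, j < n → ∀ k, k < n →
      H₄ (pQ n + 1 + 3 * (n * n) + 2 * n + j * (3 * n) + k) = H₂ (pB n + 1 + j * n + k))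
    (hothB : ∀ a, (∀ j, j < n → ¬ (pQ n + 1 + 3 * (n * n) + 2 * n + j * (3 * n) ≤ a ∧
      a < pQ n + 1 + 3 * (n * n) + 2 * n + j * (3 * n) + n)) → H₄ a = H₂ a)
    {m : ℕ} (hm : m < 3 * n * (3 * n)) : H₄ (pQ n + 1 + m) = qcell A B m := by
  have hA' : pA n = 2 * (n * n) + 103 := rfl
  have hB' : pB n = 3 * (n * n) + 104 := rfl
  have hQ : pQ n = 4 * (n * n) + 105 := rfl
  have hN : 0 < 3 * n := by
    rcases Nat.eq_zero_or_pos n with rfl | h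
    · simp at hm
    · omega
  have hdm : m / (3 * n) * (3 * n) + m % (3 * n) = m := Nat.div_add_mod' m (3 * n)
  have hvN : m % (3 * n) < 3 * n := Nat.mod_lt _ hN
  have huN : m / (3 * n) < 3 * n := Nat.div_lt_of_lt_mul hm
  -- decoding the destination windows of the two row loops
  have hinA : ∀ i, i < n → (pQ n + 1 + n + i * (3 * n) ≤ pQ n + 1 + m ∧
      pQ n + 1 + m < pQ n + 1 + n + i * (3 * n) + n) →
      m / (3 * n) = i ∧ n ≤ m % (3 * n) ∧ m % (3 * n) < 2 * n := by
    intro i _ h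
    exact (mem_window_iff (N := 3 * n) (i := i) (lo := n) (hi := 2 * n) (by omega)).1
      ⟨by omega, by omega⟩
  have hinB : ∀ j, j < n → (pQ n + 1 + 3 * (n * n) + 2 * n + j * (3 * n) ≤ pQ n + 1 + m ∧
      pQ n + 1 + m < pQ n + 1 + 3 * (n * n) + 2 * n + j * (3 * n) + n) →
      m / (3 * n) = n + j ∧ 2 * n ≤ m % (3 * n) ∧ m % (3 * n) < 3 * n := by
    intro j _ h
    have hnj : (n + j) * (3 * n) = 3 * (n * n) + j * (3 * n) := by ring
    exact (mem_window_iff (N := 3 * n) (i := n + j) (lo := 2 * n) (hi := 3 * n) le_rfl).1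
      ⟨by omega, by omega⟩
  unfold qcell
  split_ifs with hcA hcB
  · -- the arc `u₀ → (v - n)₁`
    obtain ⟨hun, hnv, hv2⟩ := hcA
    rw [hothB _ fun j hj h => by have := hinB j hj h; omega]
    have key := hrowsA (m / (3 * n)) hun (m % (3 * n) - n) (by omega)
    rw [show pQ n + 1 + n + m / (3 * n) * (3 * n) + (m % (3 * n) - n) = pQ n + 1 + m by omega]
      at key
    rw [key, show pA n + 1 + m / (3 * n) * n + (m % (3 * n) - n) =
      pA n + 1 + (m / (3 * n) * n + (m % (3 * n) - n)) by omega,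
      hH₁A _ (NegTriToAPSP.mul_add_lt_mul hun (by omega))]
  · -- the arc `(u - n)₁ → (v - 2n)₂`
    obtain ⟨hnu, hu2, h2v⟩ := hcB
    obtain ⟨d, hd⟩ := Nat.exists_eq_add_of_le hnu
    have hdn : d < n := by omega
    have hnd : (n + d) * (3 * n) = 3 * (n * n) + d * (3 * n) := by ring
    have key := hrowsB d hdn (m % (3 * n) - 2 * n) (by omega)
    rw [show pQ n + 1 + 3 * (n * n) + 2 * n + d * (3 * n) + (m % (3 * n) - 2 * n) = pQ n + 1 + m by
      rw [hd, hnd] at hdm; omega] at key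
    have hlt : d * n + (m % (3 * n) - 2 * n) < n * n := NegTriToAPSP.mul_add_lt_mul hdn (by omega)
    rw [key, hothA _ fun i hi h => by omega,
      show pB n + 1 + d * n + (m % (3 * n) - 2 * n) = pB n + 1 + (d * n + (m % (3 * n) - 2 * n)) by
        omega, hH₁B _ hlt, hd, Nat.add_sub_cancel_left]
  · -- no arc
    rw [hothB _ fun j hj h => by have := hinB j hj h; omega,
      hothA _ fun i hi h => by have := hinA i hi h; omega, hH₁hi _ (by omega)]

/-- **The query segment.** If the header cell holds `3 n` and the cells hold `qcell`, the segment
handed to the oracle is `qseg A B`. [folklore] -/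
theorem readSeg_query {H : ℕ → ℕ} (hQ₀ : H (pQ n) = 3 * n)
    (hcell : ∀ m, m < 3 * n * (3 * n) → H (pQ n + 1 + m) = qcell A B m) :
    readSeg H (pQ n) (9 * (n * n) + 1) = qseg A B := by
  refine readSeg_eq_of_forall (qseg_length A B) fun j hj => ?_
  rcases j with _ | m
  · simp [qseg, hQ₀]
  · have hm : m < 3 * n * (3 * n) := by nlinarith [hj]
    rw [show pQ n + (m + 1) = pQ n + 1 + m by omega, hcell m hm]
    simp [qseg]

/-! ### The whole run -/

/-- The answer word that the output reads for entry `t = i n + k` of the product: the code of the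
distance `i₀ ↝ k₂`, word `1 + (i N + 2 n + k)` of the answer. [folklore] -/
def ansEntry (ans : List ℕ) (n t : ℕ) : ℕ := ans.getD (1 + (t / n * (3 * n) + 2 * n + t % n)) 0

-- The symbolic execution below uses one uniform `simp only` read-normaliser per instruction;
-- not every lemma of the set fires at every instruction.
set_option linter.unusedSimpArgs false in
/-- **Semantics of the program.** On the encoding of `(A, B)`, at a word size accommodating the
input and `pTop n`, and for an oracle whose answer to `qseg A B` has `9 n² + 1` words all `< 2 ^ w - 1`,
`prog` ends within `49 n² + 27 n + 75` steps with `mem 0 = n² + 1`, `mem 1 = n`,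
`mem (2 + t) = ansEntry (O (qseg A B)) n t` for `t < n²`, having made the single query `qseg A B`.
[folklore] -/
theorem prog_spec (hwid : inputWidth (inp A B) ≤ w) (hF : pTop n < 2 ^ w)
    (hlen : (O (qseg A B)).length = 9 * (n * n) + 1) (hwv : ∀ v ∈ O (qseg A B), v + 1 < 2 ^ w) :
    ∃ st' : Store, ExecLE w O prog ⟨(init w (inp A B)).mem, []⟩ st' (49 * (n * n) + 27 * n + 75) ∧
      st'.queries = [qseg A B] ∧ st'.mem 0 = n * n + 1 ∧ st'.mem 1 = n ∧
      ∀ t, t < n * n → st'.mem (2 + t) = ansEntry (O (qseg A B)) n t := by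
  have hD : pD n = 2 * (n * n) + 102 := rfl
  have hA' : pA n = 2 * (n * n) + 103 := rfl
  have hB' : pB n = 3 * (n * n) + 104 := rfl
  have hQ : pQ n = 4 * (n * n) + 105 := rfl
  have hRR : pR n = 13 * (n * n) + 106 := rfl
  have hT : pTop n = 22 * (n * n) + 108 := rfl
  have hdQA := APSPPower.dQA_eq n; have hdOUT := APSPPower.dOUT_eq n
  have hdF : APSPPower.dFREE n < 2 ^ w := by rw [APSPPower.dFREE_eq]; omega
  have hnn : n ≤ n * n := Nat.le_mul_self n
  have h3nn : n * (3 * n) = 3 * (n * n) := by ring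
  set ans := O (qseg A B) with hans
  have hansw : ∀ k, ans.getD k 0 + 1 < 2 ^ w := fun k => by
    rw [List.getD_eq_getElem?_getD]
    cases h : ans[k]? with
    | none => simp only [Option.getD_none]; omega
    | some v => simpa using hwv v (List.mem_of_getElem? h)
  -- relocate
  have hx : ∀ v ∈ inp A B, v < 2 ^ w := fun v hv =>
    lt_of_lt_of_le (lt_two_pow_inputWidth_of_mem _ _ hv) (Nat.pow_le_pow_right Nat.two_pos hwid)
  have hrel := relocate_exec (w := w) (O := O) (x := inp A B) (by rw [inp_length]; omega) hx
    (by rw [inp_length]; omega) []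
  rw [← init_mem_eq_initFun hwid] at hrel
  -- setup
  obtain ⟨S₁, H₁, hex₁, hRg₁, h30, h31, h32, h33, h34, hQhd, hH₁⟩ := setup_spec (O := O) A B hF []
  rw [merge_self] at hex₁
  have hH₁A : ∀ t, t < n * n → H₁ (pA n + 1 + t) = codeA A t := fun t ht => by
    rw [hH₁ _ (by omega), relocated_codeA A B ht]
  have hH₁B : ∀ t, t < n * n → H₁ (pB n + 1 + t) = codeB B t := fun t ht => by
    rw [hH₁ _ (by omega), relocated_codeB A B ht]
  have hH₁hi : ∀ a, pQ n + 1 ≤ a → H₁ a = 0 := fun a ha => by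
    rw [hH₁ _ (by omega), relocated_high A B (by omega)]
  -- the rows of `A`
  have hvalA : ∀ i, i < n → ∀ j, j < n → H₁ (pA n + 1 + i * n + j) < 2 ^ w := by
    intro i hi j hj
    rw [Nat.add_assoc, hH₁A _ (NegTriToAPSP.mul_add_lt_mul hi hj)]
    exact codeA_lt A B hwid _
  obtain ⟨S₂, H₂, hex₂, hS₂, hrowsA, hothA⟩ := rowLoop_spec (w := w) (O := O) hRg₁.r2 h30 h31 h32
    h33 h34 (by omega) (by omega) (by omega) (Or.inl (by omega)) hvalA (by omega) (by omega)
    (by omega) []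
  have hRg₂ : Regs n S₂ := hRg₁.of_rowLoop hS₂
  -- the rows of `B`
  obtain ⟨S₃, hex₃, hRg₃, h30₃, h31₃, h32₃, h33₃, h34₃⟩ := preQB_spec (O := O) (H := H₂) hRg₂ hF []
  have hvalB : ∀ i, i < n → ∀ j, j < n → H₂ (pB n + 1 + i * n + j) < 2 ^ w := by
    intro i hi j hj
    have hlt := NegTriToAPSP.mul_add_lt_mul hi hj
    rw [hothA _ fun i' _ h => by omega, Nat.add_assoc, hH₁B _ hlt]
    exact codeB_lt A B hwid _
  obtain ⟨S₄, H₄, hex₄, hS₄, hrowsB, hothB⟩ := rowLoop_spec (w := w) (O := O) hRg₃.r2 h30₃ h31₃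
    h32₃ h33₃ h34₃ (by omega) (by omega) (by omega) (Or.inl (by omega)) hvalB (by omega) (by omega)
    (by omega) []
  have hRg₄ : Regs n S₄ := hRg₃.of_rowLoop hS₄
  -- the query block
  have hQ₀ : H₄ (pQ n) = 3 * n := by
    rw [hothB _ fun j _ h => by omega, hothA _ fun i _ h => by omega, hQhd]
  have hseg : readSeg H₄ (pQ n) (9 * (n * n) + 1) = qseg A B :=
    readSeg_query A B hQ₀ fun m hm => query_cells A B hH₁A hH₁B hH₁hi hrowsA hothA hrowsB hothB hm
  -- the query
  have hmap : ans.map (· % 2 ^ w) = ans := by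
    rw [List.map_congr_left (fun v hv => Nat.mod_eq_of_lt (by have := hwv v hv; omega)),
      List.map_id']
  have hexQ := Exec.query_dir (w := w) (O := O) (qa := 6) (ql := 9) (aa := 10) (by omega)
    (by omega) (by omega) (S := S₄) (by rw [hRg₄.r6]; omega) (by rw [hRg₄.r10]; omega) H₄ []
  rw [hRg₄.r6, hRg₄.r9, hRg₄.r10, hseg, ← hans, hmap, List.nil_append] at hexQ
  set H₅ := segWrite H₄ (pR n) ans with hH₅
  have hH₅at : ∀ i, i < n → ∀ k, k < n →
      H₅ (pR n + 2 + 2 * n + i * (3 * n) + k) = ans.getD (1 + (i * (3 * n) + 2 * n + k)) 0 := by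
    intro i hi k hk
    have hi3 : i * (3 * n) + 3 * n ≤ n * (3 * n) := by
      have := Nat.mul_le_mul_right (3 * n) (Nat.succ_le_of_lt hi); rwa [Nat.succ_mul] at this
    rw [hH₅]; unfold segWrite
    rw [if_neg (by omega), if_pos ⟨by omega, by rw [hlen]; omega⟩]
    congr 1; omega
  -- the answer rows
  obtain ⟨S₆, hex₆, hRg₆, h30₆, h31₆, h32₆, h33₆, h34₆⟩ :=
    preRD_spec (O := O) (H := H₅) hRg₄ hF [qseg A B]
  have hvalR : ∀ i, i < n → ∀ k, k < n → H₅ (pR n + 2 + 2 * n + i * (3 * n) + k) < 2 ^ w := by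
    intro i hi k hk
    rw [hH₅at i hi k hk]
    have := hansw (1 + (i * (3 * n) + 2 * n + k)); omega
  obtain ⟨S₇, H₇, hex₇, hS₇, hrowsR, -⟩ := rowLoop_spec (w := w) (O := O) hRg₆.r2 h30₆ h31₆
    h32₆ h33₆ h34₆ (by omega) (by omega) le_rfl (Or.inr (by omega)) hvalR (by omega) (by omega)
    (by omega) [qseg A B]
  have hRg₇ : Regs n S₇ := hRg₆.of_rowLoop hS₇
  have hres : ∀ t, t < n * n → H₇ (pA n + 1 + t) = ansEntry ans n t := by
    intro t ht
    have hn : 0 < n := Nat.pos_of_ne_zero fun h0 => by subst h0; simp at ht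
    have hdiv : t / n < n := Nat.div_lt_of_lt_mul (by rwa [Nat.mul_comm] at ht)
    have hmod : t % n < n := Nat.mod_lt _ hn
    have key := hrowsR (t / n) hdiv (t % n) hmod
    rw [show pA n + 1 + t / n * n + t % n = pA n + 1 + t by rw [Nat.add_assoc, Nat.div_add_mod']]
      at key
    rw [key, hH₅at _ hdiv _ hmod, ansEntry]
  -- re-layout and staging
  obtain ⟨S₈, hex₈, hL₈⟩ := relay_spec (O := O) (H := H₇) hRg₇ hF [qseg A B]
  set Av : ℕ → ℕ := fun t => H₇ (APSPPower.dQA n + 1 + t) with hAv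
  have hAvres : ∀ t, t < n * n → Av t = ansEntry ans n t := fun t ht => by
    rw [hAv]; simp only; rw [← pA_eq_dQA, hres t ht]
  have hAw : ∀ t, t < n * n → Av t + 1 < 2 ^ w := fun t ht => by
    rw [hAvres t ht, ansEntry]; exact hansw _
  obtain ⟨st₉, hex₉, S₉, H₉, rfl, h2₉, h3₉, -, -, h14₉, hout, hout1, -, hst⟩ :=
    APSPPower.stage_spec (O := O) hL₈ (A := Av) (fun t _ => rfl) hAw hdF [qseg A B]
  -- the final copy: preparation
  obtain ⟨st₁₀, hex₁₀, S₁₀, rfl, h0₁₀, h1₁₀⟩ : ∃ st₁₀, Exec w O (block APSPPower.finalPre)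
      ⟨merge S₉ H₉, [qseg A B]⟩ st₁₀ 2 ∧ ∃ S₁₀, st₁₀ = ⟨merge S₁₀ H₉, [qseg A B]⟩ ∧
      S₁₀ 0 = n * n + 1 ∧ S₁₀ 1 = APSPPower.dOUT n + 1 + n * n := by
    refine Exec.block_of_fwd _ _ fun R hR => ?_
    unfold APSPPower.finalPre at hR
    have htmp := execOps_cons_fwd hR; clear hR; obtain ⟨v1, hv1, hR⟩ := htmp
    simp -failIfUnchanged (disch := omega) only [Operand.write, Operand.read, merge_apply_of_lt,
      merge_apply_of_le, Function.update_self, Function.update_of_ne, update_merge_of_lt,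
      update_merge_of_le, Nat.add_zero, BinOp.eval_mod, BinOp.eval_eq, BinOp.eval_band,
      BinOp.eval_shr, BinOp.eval_div, BinOp.eval_lt, BinOp.eval_add_of_lt, BinOp.eval_sub_of_le,
      BinOp.eval_mul_of_lt, h14₉, h3₉] at hv1 hR; subst hv1
    have htmp := execOps_cons_fwd hR; clear hR; obtain ⟨v2, hv2, hR⟩ := htmp
    simp -failIfUnchanged (disch := omega) only [Operand.write, Operand.read, merge_apply_of_lt,
      merge_apply_of_le, Function.update_self, Function.update_of_ne, update_merge_of_lt,
      update_merge_of_le, Nat.add_zero, BinOp.eval_mod, BinOp.eval_eq, BinOp.eval_band,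
      BinOp.eval_shr, BinOp.eval_div, BinOp.eval_lt, BinOp.eval_add_of_lt, BinOp.eval_sub_of_le,
      BinOp.eval_mul_of_lt, h14₉, h3₉] at hv2 hR; subst hv2
    simp only [execOps_nil] at hR; subst hR
    exact ⟨_, rfl, by simp, by simp⟩
  -- switch to the plain-memory view of the final loop
  set m₀ : ℕ → ℕ := merge S₁₀ H₉ with hm₀
  have hm₀0 : APSPPower.finMem n m₀ 0 = m₀ := by
    funext a
    unfold APSPPower.finMem
    by_cases ha0 : a = 0
    · subst ha0; rw [if_pos rfl, hm₀, merge_apply_of_lt (by norm_num), h0₁₀]; rfl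
    rw [if_neg ha0]
    by_cases ha1 : a = 1
    · subst ha1; rw [if_pos rfl, hm₀, merge_apply_of_lt (by norm_num), h1₁₀]; rfl
    rw [if_neg ha1, if_neg (by omega)]
  have hstaged : ∀ t, t < n * n → 1 ≤ m₀ (APSPPower.dOUT n + 2 + t) ∧
      m₀ (APSPPower.dOUT n + 2 + t) < 2 ^ w := by
    intro t ht
    rw [hm₀, merge_apply_of_le (by omega), hst t ht]
    exact ⟨by omega, hAw t ht⟩
  have hsent : m₀ (APSPPower.dOUT n + 1) = 0 := by rw [hm₀, merge_apply_of_le (by omega), hout1]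
  have houtn : m₀ (APSPPower.dOUT n) = n + 1 := by rw [hm₀, merge_apply_of_le (by omega), hout]
  have hex₁₁ := APSPPower.finalLoop_spec (O := O) hstaged hsent hdF [qseg A B]
  rw [hm₀0, Finset.sum_const, Finset.card_range, smul_eq_mul] at hex₁₁
  have hex₁₂ := APSPPower.finalPost_spec (O := O) (m₀ := m₀) houtn hdF [qseg A B]
  -- assemble the execution
  have hexAll := hrel.execLE.seqs_cons (hex₁.execLE.seqs_cons (hex₂.seqs_cons
    (hex₃.execLE.seqs_cons (hex₄.seqs_cons (hexQ.execLE.seqs_cons (hex₆.execLE.seqs_cons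
    (hex₇.seqs_cons (hex₈.execLE.seqs_cons (hex₉.seqs_cons (hex₁₀.execLE.seqs_cons
    (hex₁₁.execLE.seqs_cons (ExecLE.seqs_one hex₁₂.execLE))))))))))))
  have htime : n * (6 * n + 9) = 6 * (n * n) + 9 * n := by ring
  refine ⟨_, hexAll.mono ?_, rfl, ?_, ?_, ?_⟩
  · rw [inp_length]; omega
  · show Function.update (Function.update (APSPPower.finMem n m₀ (n * n)) 1 n) 0 (n * n + 1) 0 = _
    rw [Function.update_self]
  · show Function.update (Function.update (APSPPower.finMem n m₀ (n * n)) 1 n) 0 (n * n + 1) 1 = _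
    rw [Function.update_of_ne (by norm_num), Function.update_self]
  · intro t ht
    show Function.update (Function.update (APSPPower.finMem n m₀ (n * n)) 1 n) 0 (n * n + 1) (2 + t) = _
    rw [Function.update_of_ne (by omega), Function.update_of_ne (by omega)]
    unfold APSPPower.finMem
    rw [if_neg (by omega), if_neg (by omega), if_pos ⟨by omega, by omega⟩, hm₀,
      merge_apply_of_le (by omega), show APSPPower.dOUT n + (2 + t) = APSPPower.dOUT n + 2 + t by
        omega, hst t ht, Nat.add_sub_cancel, hAvres t ht]

end semantics

/-! ### The query is the product layered graph; the output is the distance product -/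

section identify

variable {n : ℕ} (A B : Matrix (Fin n) (Fin n) (WithTop ℤ))

/-- `x / n = k` iff `x` lies in the window `[k n, (k + 1) n)`. [folklore] -/
theorem div_eq_iff_window {x n k : ℕ} (hn : 0 < n) : x / n = k ↔ k * n ≤ x ∧ x < (k + 1) * n := by
  rw [← Nat.le_div_iff_mul_le hn, ← Nat.div_lt_iff_lt_mul hn]; omega

/-- The code of entry `(i, j)` of `A`. [folklore] -/
theorem codeA_eq (i j : Fin n) : codeA A (i * n + j) = encodeWithTopInt (A i j) :=
  APSPPower.code_eq A i j

/-- The code of entry `(j, k)` of `B`. [folklore] -/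
theorem codeB_eq (j k : Fin n) : codeB B (j * n + k) = encodeWithTopInt (B j k) :=
  APSPPower.code_eq B j k

/-- **Cell `m` of the query matrix is the code of entry `(m / N, m mod N)` of the product layered
graph** (`N = 3 n`; layers decoded by a second division by `n`). [folklore] -/
theorem qcell_eq (m : Fin (3 * n * (3 * n))) :
    qcell A B m = encodeWithTopInt (productLayeredGraph A B m.divNat m.modNat) := by
  have hn : 0 < n := by
    rcases Nat.eq_zero_or_pos n with h0 | h
    · subst h0; exact absurd m.isLt (by simp)
    · exact h
  have hU3 : (m : ℕ) / (3 * n) < 3 * n := Nat.div_lt_of_lt_mul m.isLt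
  have hV3 : (m : ℕ) % (3 * n) < 3 * n := Nat.mod_lt _ (by omega)
  have hdivU : ((m.divNat).divNat : ℕ) = (m : ℕ) / (3 * n) / n := by simp
  have hmodU : ((m.divNat).modNat : ℕ) = (m : ℕ) / (3 * n) % n := by simp
  have hdivV : ((m.modNat).divNat : ℕ) = (m : ℕ) % (3 * n) / n := by simp
  have hmodV : ((m.modNat).modNat : ℕ) = (m : ℕ) % (3 * n) % n := by simp
  rw [productLayeredGraph_apply, hdivU, hdivV]
  unfold qcell
  by_cases hcA : (m : ℕ) / (3 * n) < n ∧ n ≤ (m : ℕ) % (3 * n) ∧ (m : ℕ) % (3 * n) < 2 * n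
  · have h1 : (m : ℕ) / (3 * n) / n = 0 := (div_eq_iff_window hn).2 ⟨by simp, by omega⟩
    have h2 : (m : ℕ) % (3 * n) / n = 1 := (div_eq_iff_window hn).2 ⟨by omega, by omega⟩
    rw [if_pos hcA, if_pos ⟨h1, h2⟩, ← codeA_eq A]
    congr 1
    rw [hmodU, hmodV, Nat.mod_eq_of_lt hcA.1, Nat.mod_eq_sub_mod hcA.2.1,
      Nat.mod_eq_of_lt (show (m : ℕ) % (3 * n) - n < n by omega)]
  · rw [if_neg hcA]
    by_cases hcB : n ≤ (m : ℕ) / (3 * n) ∧ (m : ℕ) / (3 * n) < 2 * n ∧ 2 * n ≤ (m : ℕ) % (3 * n)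
    · have h1 : (m : ℕ) / (3 * n) / n = 1 := (div_eq_iff_window hn).2 ⟨by omega, by omega⟩
      have h2 : (m : ℕ) % (3 * n) / n = 2 := (div_eq_iff_window hn).2 ⟨by omega, by omega⟩
      rw [if_pos hcB, if_neg (by rw [h1]; omega), if_pos ⟨h1, h2⟩, ← codeB_eq B]
      congr 1
      rw [hmodU, hmodV, Nat.mod_eq_sub_mod hcB.1,
        Nat.mod_eq_of_lt (show (m : ℕ) / (3 * n) - n < n by omega),
        Nat.mod_eq_sub_mod (show n ≤ (m : ℕ) % (3 * n) by omega),
        Nat.mod_eq_sub_mod (show n ≤ (m : ℕ) % (3 * n) - n by omega),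
        Nat.mod_eq_of_lt (show (m : ℕ) % (3 * n) - n - n < n by omega)]
      omega
    · rw [if_neg hcB]
      have h1 : ¬ ((m : ℕ) / (3 * n) / n = 0 ∧ (m : ℕ) % (3 * n) / n = 1) := by
        rintro ⟨h1, h2⟩
        rw [div_eq_iff_window hn] at h1 h2
        exact hcA ⟨by omega, by omega, by omega⟩
      have h2 : ¬ ((m : ℕ) / (3 * n) / n = 1 ∧ (m : ℕ) % (3 * n) / n = 2) := by
        rintro ⟨h1, h2⟩
        rw [div_eq_iff_window hn] at h1 h2
        exact hcB ⟨by omega, by omega, by omega⟩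
      rw [if_neg h1, if_neg h2]
      rfl

/-- **The query is the product layered graph**: the segment handed to the APSP oracle is exactly
`encodeMatrixWithTop (productLayeredGraph A B)`. [folklore] -/
theorem qseg_eq : qseg A B = encodeMatrixWithTop (productLayeredGraph A B) := by
  rw [qseg, NegTriToAPSP.encodeMatrixWithTop_eq_cons_ofFn]
  exact congrArg _ (congrArg List.ofFn (funext fun m => qcell_eq A B m))

/-- The words of the oracle's answer (the encoded distance matrix of the product layered graph of a
`MinPlusProduct c` instance) are at most `max (3 n) (6 n^{c+1} + 1)`. [folklore] -/
theorem answer_entries_le (c : ℕ) (hA : HasBoundedWeights A (n ^ c)) (hB : HasBoundedWeights B (n ^ c)) :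
    ∀ v ∈ encodeMatrixWithTop (shortestDist (productLayeredGraph A B)),
      v ≤ max (3 * n) (2 * (3 * n * n ^ c) + 1) :=
  forall_mem_encodeMatrixWithTop_le (hasBoundedWeights_shortestDist_productLayeredGraph A B hA hB)

/-- **The answer words read by the output are the codes of the distance product**: word
`1 + (i N + 2 n + k)` of `⌜shortestDist G⌝` is the code of the distance `i₀ ↝ k₂`, i.e. of
`minPlusProduct A B i k` (`shortestDist_productLayeredGraph`). [folklore] -/
theorem ansEntry_eq (i k : Fin n) :
    ansEntry (encodeMatrixWithTop (shortestDist (productLayeredGraph A B))) n (i * n + k) =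
      encodeWithTopInt (minPlusProduct A B i k) := by
  set G := productLayeredGraph A B with hG
  rw [← shortestDist_productLayeredGraph A B i k, ansEntry, NegTriToAPSP.div_of_mul_add k.isLt,
    APSPPower.mul_add_mod_eq k.isLt]
  have h2 : ((2 : Fin 3) : ℕ) = 2 := rfl
  have hidx : 1 + ((i : ℕ) * (3 * n) + 2 * n + k) =
      ((Fin.mkDivMod (0 : Fin 3) i : Fin (3 * n)) : ℕ) * (3 * n) +
        ((Fin.mkDivMod (2 : Fin 3) k : Fin (3 * n)) : ℕ) + 1 := by
    simp only [Fin.coe_mkDivMod, Fin.val_zero, h2]; ring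
  have hlt' := NegTriToAPSP.mul_add_lt_mul (Fin.mkDivMod (0 : Fin 3) i).is_lt
    (Fin.mkDivMod (2 : Fin 3) k).is_lt
  have hlt : ((Fin.mkDivMod (0 : Fin 3) i : Fin (3 * n)) : ℕ) * (3 * n) +
      ((Fin.mkDivMod (2 : Fin 3) k : Fin (3 * n)) : ℕ) + 1 < (encodeMatrixWithTop (shortestDist G)).length := by
    rw [encodeMatrixWithTop_length, sq]; omega
  rw [hidx, List.getD_eq_getElem _ _ hlt, NegTriToAPSP.getElem_encodeMatrixWithTop_succ _ _ hlt' hlt,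
    NegTriToAPSP.divNat_mk_mul_add, NegTriToAPSP.modNat_mk_mul_add]

/-- **The output is the encoded distance product**: a memory with `mem 0 = n² + 1`, `mem 1 = n` and
`mem (2 + t)` the answer word of the distance `(t / n)₀ ↝ (t mod n)₂` reads out as
`encodeMatrixWithTop (minPlusProduct A B)`. [folklore] -/
theorem readOut_eq {M : ℕ → ℕ} (h0 : M 0 = n * n + 1) (h1 : M 1 = n)
    (h2 : ∀ t, t < n * n →
      M (2 + t) = ansEntry (encodeMatrixWithTop (shortestDist (productLayeredGraph A B))) n t) :
    readOut M = encodeMatrixWithTop (minPlusProduct A B) := by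
  unfold readOut
  rw [h0]
  apply List.ext_getElem
  · rw [readSeg_length, encodeMatrixWithTop_length, sq]
  intro j hj hj'
  rw [readSeg_length] at hj
  simp only [readSeg, List.getElem_map, List.getElem_range]
  rcases j with _ | t
  · rw [Nat.add_zero, h1, NegTriToAPSP.getElem_encodeMatrixWithTop_zero]
  · have ht : t < n * n := by omega
    have hn : 0 < n := Nat.pos_of_ne_zero fun hn0 => by subst hn0; simp at ht
    rw [show 1 + (t + 1) = 2 + t by omega, h2 t ht, NegTriToAPSP.getElem_encodeMatrixWithTop_succ _ t ht]
    have key := ansEntry_eq A B ⟨t / n, Nat.div_lt_of_lt_mul (by rwa [Nat.mul_comm] at ht)⟩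
      ⟨t % n, Nat.mod_lt _ hn⟩
    simp only at key
    rw [Nat.div_add_mod' t n] at key
    rw [key]
    rfl

end identify

/-! ### Capacity of the word size; the budgets -/

/-- All addresses fit: `pTop n = 22 n² + 108 < (2 n² + 3)^{c+8}`. [folklore] -/
theorem pTop_lt_capacity (n c : ℕ) : pTop n < (2 * (n * n) + 2 + 1) ^ (c + 8) := by
  have h1 : pTop n ≤ 36 * (2 * (n * n) + 2 + 1) := by unfold pTop; omega
  have h2 : 36 < (2 * (n * n) + 2 + 1) ^ (c + 7) :=
    calc (36 : ℕ) < 3 ^ 7 := by norm_num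
      _ ≤ 3 ^ (c + 7) := Nat.pow_le_pow_right (by norm_num) (by omega)
      _ ≤ (2 * (n * n) + 2 + 1) ^ (c + 7) := Nat.pow_le_pow_left (by omega) _
  calc pTop n ≤ 36 * (2 * (n * n) + 2 + 1) := h1
    _ < (2 * (n * n) + 2 + 1) ^ (c + 7) * (2 * (n * n) + 2 + 1) :=
        Nat.mul_lt_mul_of_pos_right h2 (by omega)
    _ = (2 * (n * n) + 2 + 1) ^ (c + 8) := by ring

/-- The answer words, shifted by one for the staging, fit:
`max (3 n) (6 n^{c+1} + 1) + 1 < (2 n² + 3)^{c+8}`. [folklore] -/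
theorem answer_lt_capacity (n c : ℕ) :
    max (3 * n) (2 * (3 * n * n ^ c) + 1) + 1 < (2 * (n * n) + 2 + 1) ^ (c + 8) := by
  set X := 2 * (n * n) + 2 + 1 with hX
  have hX3 : 3 ≤ X := by omega
  have hnX : n ≤ X := by rw [hX]; nlinarith
  have hc : n ^ c ≤ X ^ c := Nat.pow_le_pow_left hnX c
  have h1 : 3 * n * n ^ c ≤ 3 * X ^ (c + 1) := by
    rw [pow_succ]
    calc 3 * n * n ^ c ≤ 3 * X * X ^ c := Nat.mul_le_mul (Nat.mul_le_mul_left 3 hnX) hc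
      _ = 3 * (X ^ c * X) := by ring
  have h2 : X ^ (c + 1) * 27 ≤ X ^ (c + 8) := by
    calc X ^ (c + 1) * 27 ≤ X ^ (c + 1) * X ^ 7 :=
          Nat.mul_le_mul_left _ (le_trans (by norm_num : 27 ≤ 3 ^ 7) (Nat.pow_le_pow_left hX3 7))
      _ = X ^ (c + 8) := by rw [← pow_add]
  have h3 : 1 ≤ X ^ (c + 1) := Nat.one_le_pow _ _ (by omega)
  have h4 : n ≤ X ^ (c + 1) := le_trans hnX (by
    calc X = X ^ 1 := (pow_one X).symm
      _ ≤ X ^ (c + 1) := Nat.pow_le_pow_right (by omega) (by omega))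
  omega

/-- The ledger estimate for the single query of size `3 n`: `((3n)³)^{1-ε} ≤ 27 (n³)^{1-δ} + 1`
whenever `0 ≤ ε` and `δ ≤ ε`. [folklore] -/
theorem ledger_le_three {ε δ : ℝ} (hε : 0 ≤ ε) (hδε : δ ≤ ε) (n : ℕ) :
    (((3 * n : ℕ) : ℝ) ^ (3 : ℝ)) ^ (1 - ε) ≤ 27 * ((n : ℝ) ^ (3 : ℝ)) ^ (1 - δ) + 1 := by
  have h0 : (0 : ℝ) ≤ ((n : ℝ) ^ (3 : ℝ)) ^ (1 - δ) :=
    Real.rpow_nonneg (Real.rpow_nonneg (Nat.cast_nonneg _) _) _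
  rcases Nat.eq_zero_or_pos n with rfl | hn
  · have e : (((3 * 0 : ℕ) : ℝ) ^ (3 : ℝ)) = 0 := by
      rw [Nat.mul_zero, Nat.cast_zero, Real.zero_rpow (by norm_num)]
    calc (((3 * 0 : ℕ) : ℝ) ^ (3 : ℝ)) ^ (1 - ε) = (0 : ℝ) ^ (1 - ε) := by rw [e]
      _ ≤ 1 := Real.zero_rpow_le_one _
      _ ≤ 27 * (((0 : ℕ) : ℝ) ^ (3 : ℝ)) ^ (1 - δ) + 1 := by linarith [h0]
  · have hn1 : (1 : ℝ) ≤ n := by exact_mod_cast hn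
    have ha : (1 : ℝ) ≤ (n : ℝ) ^ (3 : ℝ) := Real.one_le_rpow hn1 (by norm_num)
    have ha0 : (0 : ℝ) ≤ (n : ℝ) ^ (3 : ℝ) := le_trans zero_le_one ha
    have h27 : ((3 * n : ℕ) : ℝ) ^ (3 : ℝ) = 27 * (n : ℝ) ^ (3 : ℝ) := by
      push_cast
      rw [Real.mul_rpow (by norm_num) (Nat.cast_nonneg n)]
      congr 1
      rw [show (3 : ℝ) = ((3 : ℕ) : ℝ) by norm_num, Real.rpow_natCast]
      norm_num
    rw [h27, Real.mul_rpow (by norm_num) ha0]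
    have h1 : (27 : ℝ) ^ (1 - ε) ≤ 27 := by
      conv_rhs => rw [← Real.rpow_one 27]
      exact Real.rpow_le_rpow_of_exponent_le (by norm_num) (by linarith)
    have h2 : ((n : ℝ) ^ (3 : ℝ)) ^ (1 - ε) ≤ ((n : ℝ) ^ (3 : ℝ)) ^ (1 - δ) :=
      Real.rpow_le_rpow_of_exponent_le ha (by linarith)
    have h3 : (0 : ℝ) ≤ ((n : ℝ) ^ (3 : ℝ)) ^ (1 - ε) := Real.rpow_nonneg ha0 _
    have := mul_le_mul h1 h2 h3 (by norm_num)
    linarith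

/-! ### The reduction -/

/-- **VW–W 2018, proof of Thm. 5.1 (distance product `≤₃` APSP), proved with the same weight
exponent**: for every `c`, the `(min,+)`-product with entries in `[-nᶜ, nᶜ] ∪ {∞}` reduces to APSP
with weights in `[-Nᶜ, Nᶜ]` by the verified word-RAM program `prog` — one APSP query on the product
layered graph (`N = 3 n` vertices), `O(n²)` time, word size `(c + 8) · width`; for every `ε > 0` the
definition of `FGReducible` (VVW ICM 2018, Def. 2.1) is met with `δ = min ε (1/3)` and `C = 80`.
[cite: VassilevskaWilliamsWilliams2018, proof of Thm. 5.1 (p. 27:22)] -/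
theorem minPlusProduct_fgReducible_APSP_same (c : ℕ) :
    FGReducible (MinPlusProduct c) (fun n => (n : ℝ) ^ (3 : ℝ)) (APSP c)
      (fun n => (n : ℝ) ^ (3 : ℝ)) := by
  intro ε hε
  refine ⟨min ε (1 / 3), lt_min hε (by norm_num), prog.toProgram, c + 8, 80, prog_isDeterministic, ?_⟩
  intro O hO x
  obtain ⟨⟨n, A, B⟩, hAb, hBb⟩ := x
  change HasBoundedWeights A (n ^ c) at hAb
  change HasBoundedWeights B (n ^ c) at hBb
  have hδ3 : min ε (1 / 3) ≤ 1 / 3 := min_le_right _ _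
  have hδε : min ε (1 / 3) ≤ ε := min_le_left _ _
  have hbud0 : (0 : ℝ) ≤ ((n : ℝ) ^ (3 : ℝ)) ^ (1 - min ε (1 / 3)) :=
    Real.rpow_nonneg (Real.rpow_nonneg (Nat.cast_nonneg _) _) _
  have hsq := NegTriToAPSP.sq_le_budget hδ3 n
  -- the APSP instance queried
  set G := productLayeredGraph A B with hG
  let y : (APSP c).Inst := ⟨⟨3 * n, G⟩, productLayeredGraph_mem_APSP A B c hAb hBb⟩
  -- the word size
  set w : ℕ := (c + 8) * inputWidth (inp A B) with hw_def
  have hwid : inputWidth (inp A B) ≤ w := inputWidth_le_mul (by omega) _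
  have hcap : ∀ v, v < (2 * (n * n) + 2 + 1) ^ (c + 8) → v < 2 ^ w := fun v hv =>
    lt_two_pow_mul_inputWidth (by rw [inp_length]; exact hv)
  have hF : pTop n < 2 ^ w := hcap _ (pTop_lt_capacity n c)
  -- the oracle's answer
  have hans_eq : O (qseg A B) = encodeMatrixWithTop (shortestDist G) := by
    have := hO y
    rw [APSP_good, Set.mem_singleton_iff] at this
    rw [qseg_eq]
    exact this
  have hlen : (O (qseg A B)).length = 9 * (n * n) + 1 := by
    rw [hans_eq, encodeMatrixWithTop_length, sq]; ring
  have hwv : ∀ v ∈ O (qseg A B), v + 1 < 2 ^ w := by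
    rw [hans_eq]
    intro v hv
    exact hcap _ (lt_of_le_of_lt (Nat.add_le_add_right (answer_entries_le A B c hAb hBb v hv) 1)
      (answer_lt_capacity n c))
  obtain ⟨st', ⟨t, ht, hex⟩, hqs, hM0, hM1, hM2⟩ := prog_spec (O := O) A B hwid hF hlen hwv
  refine ⟨st'.cfg none 0, [y], ?_, ?_, ?_, ?_, ?_⟩
  · -- the run halts within the budget
    refine haltsWithin_toProgram hex (Nat.le_floor ?_) zeroCoins
    change ((t + 1 : ℕ) : ℝ) ≤ 80 * ((n : ℝ) ^ (3 : ℝ)) ^ (1 - min ε (1 / 3)) + 80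
    have hnn : (n : ℝ) ≤ (n : ℝ) * n := by exact_mod_cast Nat.le_mul_self n
    have ht' : ((t + 1 : ℕ) : ℝ) ≤ 49 * ((n : ℝ) * n) + 27 * n + 76 := by
      exact_mod_cast (show t + 1 ≤ 49 * (n * n) + 27 * n + 76 by omega)
    nlinarith
  · -- the output is the accepted one
    show readOut st'.mem ∈ ({encodeMatrixWithTop (minPlusProduct A B)} : Set (List ℕ))
    rw [Set.mem_singleton_iff]
    exact readOut_eq A B hM0 hM1 fun t ht => by rw [hM2 t ht, hans_eq]
  · -- the query log lists the encoding of the queried instance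
    change st'.queries = [encodeMatrixWithTop G]
    rw [hqs, qseg_eq]
  · -- the ledger of Def. 2.1
    simp only [List.map_cons, List.map_nil, List.sum_cons, List.sum_nil, add_zero]
    change (((3 * n : ℕ) : ℝ) ^ (3 : ℝ)) ^ (1 - ε) ≤ 80 * ((n : ℝ) ^ (3 : ℝ)) ^ (1 - min ε (1 / 3)) + 80
    have := ledger_le_three hε.le hδε n
    linarith
  · -- the total query length
    simp only [List.map_cons, List.map_nil, List.sum_cons, List.sum_nil, add_zero]
    change (((encodeMatrixWithTop G).length : ℕ) : ℝ) ≤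
      80 * ((n : ℝ) ^ (3 : ℝ)) ^ (1 - min ε (1 / 3)) + 80
    rw [encodeMatrixWithTop_length]
    push_cast
    nlinarith

end Literature.Computability.FineGrained.MinPlusToAPSP

namespace Literature.Computability.FineGrained

/-- **Discharge of `minPlusProduct_fgReducible_APSP`** (VW–W 2018, proof of Thm. 5.1, p. 27:22: the
distance product as one APSP computation on the tripartite `I, J, K` graph): take `c' = c`.
[cite: VassilevskaWilliamsWilliams2018, proof of Thm. 5.1 (p. 27:22)] -/
theorem minPlusProduct_fgReducible_APSP_holds : minPlusProduct_fgReducible_APSP :=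
  fun c => ⟨c, MinPlusToAPSP.minPlusProduct_fgReducible_APSP_same c⟩

end Literature.Computability.FineGrained
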